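import Summits.AtomisticToContinuum.HydrodynamicLimit.Theorems.CollisionIsometryCLTAdaptedWeightCLTBHEEPClosureMoments

/-!
# Stub `stub_eepClosure` (S5) of the line `block-h-dissipation-closure`, helper file 2: the REGULARISED LAW OF A
VELOCITY CLOUD and its EXACT `(1 − δ)` MOMENT IDENTITIES
(crux `CollisionIsometryCLT.AdaptedWeightCLT`, stmt-AtomisticToContinuum-14868; `--supports`)

Step (iv) of the planner's sketch of `stub_eepClosure`, assembled over a cell. A VELOCITY CLOUD is a finite family of
velocities `v_i ∈ ℝ³` with probability weights `p_i ≥ 0`, `Σ p_i = 1` (a cell of the vocabulary read through its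
normalised weights `ψ_N(x_i − x)/W_x`; the bridge is helper file 3). Its mean `ū = Σ p_i v_i` (`cloudMean`),
temperature `θ̄ = Σ p_i |v_i − ū|²/3` (`cloudTemp`), kernel density estimate `f̃ = Σ p_i G_h(· − v_i)` (`cloudKde`),
co-moving co-thermal Maxwellian floor `M = M_{1, θ̄ + h², ū}` (`cloudMaxw`) and REGULARISED LAW
`f̂ = (1 − δ) f̃ + δ M` (`cloudLaw`, the vocabulary's `cellLaw`) satisfy, EXACTLY:
* `∫ f̂ = 1`, `f̂ > 0`, `δ M ≤ f̂ ≤ (2π h²)^{-3/2}` (`integral_cloudLaw`, `cloudLaw_pos`, `cloudLaw_le`);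
* `∫ f̂ p₂ = (1 − δ) Σ_i p_i p₂(v_i)` for the traceless quadratic tests centred at `ū` (`integral_cloudLaw_mul_p2Poly`);
* `∫ f̂ p₃ = (1 − δ) Σ_i p_i p₃(v_i)` for the heat-flux tests centred at `ū` (`integral_cloudLaw_mul_p3Poly`): the
  per-atom shifts `(5/2) h² (v_i − ū)_a` of helper file 1 cancel against the probability weights because the floor is
  CO-MOVING (all mixture components are centred by the same `ū`), and the centred floor has no third moment.
So `traceless Cov(f̂) = (1 − δ) traceless Cov(f)` and `μ₃(f̂) = (1 − δ) μ₃(f)` for the atomic cell law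
`f = Σ p_i δ_{v_i}`: the cell's traceless kinetic stress and kinetic heat flux are read off the regularised law with
no `h → 0`, `δ → 0`. (That `M` IS the Maxwellian `M^{f̂}` with the mass, momentum and energy of `f̂` — mass `1`, mean
`ū`, temperature `(1−δ)(θ̄ + h²) + δ(θ̄ + h²) = θ̄ + h²` — is the reason the floor is co-thermal; it is used in the
statement of the cited entropy–entropy-production fact of helper file 5.)
Registered anchor: `bhEEPClosure_cloud_anchor` (unit mass of the regularised law, `∀`-closed, defs unfolded).
-/

namespace Summit.AtomisticToContinuum.HydrodynamicLimit.Theorems.BlockHDissipation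

open scoped BigOperators Topology Classical MeasureTheory ENNReal InnerProductSpace
open Filter Set MeasureTheory ProbabilityTheory
open Literature.Analysis.FluidPDE
open Summit.AtomisticToContinuum.HydrodynamicLimit.Theorems.ContactSourceDuhamel (T3 V3 Cfg Vel Flow Flows)
open Literature.MathematicalPhysics.KineticTheory (localMaxwellian_pos localMaxwellian_nonneg continuous_localMaxwellian
  integral_localMaxwellian_one integrable_localMaxwellian)

noncomputable section

namespace EEP

open EntropyBudget (gauss_eq gauss_pos lM_le_gMax)
open DVTransfer (continuous_gauss)

variable {n : ℕ}

/-! ## Objects -/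

/-- Mean of the cloud: `ū = Σ p_i v_i`. -/
def cloudMean (p : Fin n → ℝ) (v : Fin n → V3) : V3 := ∑ i, p i • v i

/-- Temperature of the cloud: `θ̄ = Σ p_i |v_i − ū|² / 3`. -/
def cloudTemp (p : Fin n → ℝ) (v : Fin n → V3) : ℝ := (∑ i, p i * ‖v i - cloudMean p v‖ ^ 2) / 3

/-- Gaussian kernel density estimate of the cloud: `f̃ = Σ p_i G_h(· − v_i)`. -/
def cloudKde (h : ℝ) (p : Fin n → ℝ) (v : Fin n → V3) (w : V3) : ℝ := ∑ i, p i * gauss h (v i) w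

/-- The co-moving co-thermal Maxwellian floor `M_{1, θ̄ + h², ū}`. -/
def cloudMaxw (h : ℝ) (p : Fin n → ℝ) (v : Fin n → V3) (w : V3) : ℝ :=
  localMaxwellian 1 (cloudTemp p v + h ^ 2) (cloudMean p v) w

/-- The REGULARISED LAW of the cloud: `f̂ = (1 − δ) f̃ + δ M_{1, θ̄ + h², ū}`. -/
def cloudLaw (h δ : ℝ) (p : Fin n → ℝ) (v : Fin n → V3) (w : V3) : ℝ :=
  (1 - δ) * cloudKde h p v w + δ * cloudMaxw h p v w

/-- Traceless second central moment of the atomic cloud: `Σ_i p_i p₂(v_i)` (tests centred at `ū`). -/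
def cloudP2 (p : Fin n → ℝ) (v : Fin n → V3) (j k : Fin 3) : ℝ := ∑ i, p i * p2Poly (cloudMean p v) j k (v i)

/-- Half third central moment contraction of the atomic cloud: `Σ_i p_i p₃(v_i)` (tests centred at `ū`). -/
def cloudP3 (p : Fin n → ℝ) (v : Fin n → V3) (a : Fin 3) : ℝ := ∑ i, p i * p3Poly (cloudMean p v) a (v i)

/-! ## Elementary properties -/

section Basic

variable {h δ : ℝ} {p : Fin n → ℝ} {v : Fin n → V3}

/-- The temperature is nonnegative. -/
theorem cloudTemp_nonneg (hp : ∀ i, 0 ≤ p i) (v : Fin n → V3) : 0 ≤ cloudTemp p v :=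
  div_nonneg (Finset.sum_nonneg fun i _ => mul_nonneg (hp i) (sq_nonneg _)) (by norm_num)

/-- The floor temperature `θ̄ + h²` is positive. -/
theorem cloudTemp_add_sq_pos (hp : ∀ i, 0 ≤ p i) (v : Fin n → V3) (hh : 0 < h) : 0 < cloudTemp p v + h ^ 2 :=
  add_pos_of_nonneg_of_pos (cloudTemp_nonneg hp v) (pow_pos hh 2)

/-- Components of the mean. -/
theorem cloudMean_apply (p : Fin n → ℝ) (v : Fin n → V3) (a : Fin 3) : cloudMean p v a = ∑ i, p i * v i a := by
  simp only [cloudMean, WithLp.ofLp_sum, Finset.sum_apply, PiLp.smul_apply, smul_eq_mul]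

/-- The first central moment of a probability cloud vanishes (componentwise). -/
theorem sum_mul_sub_cloudMean (hp1 : ∑ i, p i = 1) (v : Fin n → V3) (a : Fin 3) :
    ∑ i, p i * (v i a - cloudMean p v a) = 0 := by
  simp only [mul_sub, Finset.sum_sub_distrib, ← Finset.sum_mul, hp1, one_mul, cloudMean_apply, sub_self]

/-- The kernel density estimate is nonnegative. -/
theorem cloudKde_nonneg (hp : ∀ i, 0 ≤ p i) (hh : 0 < h) (w : V3) : 0 ≤ cloudKde h p v w :=
  Finset.sum_nonneg fun i _ => mul_nonneg (hp i) (gauss_pos hh (v i) w).le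

/-- The floor is positive. -/
theorem cloudMaxw_pos (hp : ∀ i, 0 ≤ p i) (hh : 0 < h) (w : V3) : 0 < cloudMaxw h p v w :=
  localMaxwellian_pos one_pos (cloudTemp_add_sq_pos hp v hh) _ w

/-- The regularised law dominates `δ` times its floor. -/
theorem delta_mul_cloudMaxw_le (hp : ∀ i, 0 ≤ p i) (hh : 0 < h) (hδ1 : δ ≤ 1) (w : V3) :
    δ * cloudMaxw h p v w ≤ cloudLaw h δ p v w :=
  le_add_of_nonneg_left (mul_nonneg (sub_nonneg.2 hδ1) (cloudKde_nonneg hp hh w))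

/-- The regularised law is positive (`0 < δ ≤ 1`). -/
theorem cloudLaw_pos (hp : ∀ i, 0 ≤ p i) (hh : 0 < h) (hδ : 0 < δ) (hδ1 : δ ≤ 1) (w : V3) : 0 < cloudLaw h δ p v w :=
  lt_of_lt_of_le (mul_pos hδ (cloudMaxw_pos hp hh w)) (delta_mul_cloudMaxw_le hp hh hδ1 w)

/-- **Upper bound**: `f̂ ≤ (2π h²)^{-3/2}` for a probability cloud and `0 ≤ δ ≤ 1`. -/
theorem cloudLaw_le (hp : ∀ i, 0 ≤ p i) (hp1 : ∑ i, p i = 1) (hh : 0 < h) (hδ : 0 ≤ δ) (hδ1 : δ ≤ 1) (w : V3) :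
    cloudLaw h δ p v w ≤ (2 * Real.pi * h ^ 2) ^ (-(3 : ℝ) / 2) := by
  set C := (2 * Real.pi * h ^ 2) ^ (-(3 : ℝ) / 2)
  have hK : cloudKde h p v w ≤ C := by
    calc cloudKde h p v w ≤ ∑ i, p i * C :=
          Finset.sum_le_sum fun i _ => mul_le_mul_of_nonneg_left (lM_le_gMax hh le_rfl _ _) (hp i)
      _ = C := by rw [← Finset.sum_mul, hp1, one_mul]
  have hM : cloudMaxw h p v w ≤ C :=
    lM_le_gMax hh (le_add_of_nonneg_left (cloudTemp_nonneg hp v)) _ _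
  calc cloudLaw h δ p v w ≤ (1 - δ) * C + δ * C :=
        add_le_add (mul_le_mul_of_nonneg_left hK (sub_nonneg.2 hδ1)) (mul_le_mul_of_nonneg_left hM hδ)
    _ = C := by ring

/-- The regularised law is continuous. -/
theorem continuous_cloudLaw (h δ : ℝ) (p : Fin n → ℝ) (v : Fin n → V3) : Continuous (cloudLaw h δ p v) := by
  have hg : ∀ i, Continuous (gauss h (v i)) := fun i => continuous_gauss h (v i)
  have hM : Continuous (cloudMaxw h p v) := continuous_localMaxwellian _ _ _
  show Continuous fun w => cloudLaw h δ p v w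
  unfold cloudLaw cloudKde
  fun_prop

end Basic

/-! ## Integrals against the regularised law -/

section Integrals

variable {h δ : ℝ} {p : Fin n → ℝ} {v : Fin n → V3}

/-- Integrability of `f̂ g` for a continuous `g` of polynomial growth, term by term. -/
theorem integrable_cloudKde_term (hh : 0 < h) (i : Fin n) {g : V3 → ℝ} (hg : Continuous g) {C : ℝ} {k : ℕ}
    (hle : ∀ w, |g w| ≤ C * (1 + ‖w‖) ^ k) : Integrable (fun w => p i * gauss h (v i) w * g w) := by
  simpa only [mul_assoc] using (integrable_gauss_mul_of_le hh (v i) hg hle).const_mul (p i)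

/-- Integrability of `M g` for the floor. -/
theorem integrable_cloudMaxw_mul (hp : ∀ i, 0 ≤ p i) (hh : 0 < h) {g : V3 → ℝ} (hg : Continuous g) {C : ℝ} {k : ℕ}
    (hle : ∀ w, |g w| ≤ C * (1 + ‖w‖) ^ k) : Integrable (fun w => cloudMaxw h p v w * g w) :=
  integrable_localMaxwellian_mul_of_le (cloudTemp_add_sq_pos hp v hh) _ hg hle

/-- **Integration against the regularised law, term by term**:
`∫ f̂ g = (1 − δ) (Σ_i p_i ∫ G_h(· − v_i) g) + δ ∫ M g`. -/
theorem integral_cloudLaw_mul (hp : ∀ i, 0 ≤ p i) (hh : 0 < h) {g : V3 → ℝ} (hg : Continuous g) {C : ℝ} {k : ℕ}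
    (hle : ∀ w, |g w| ≤ C * (1 + ‖w‖) ^ k) :
    ∫ w, cloudLaw h δ p v w * g w =
      (1 - δ) * (∑ i, p i * ∫ w, gauss h (v i) w * g w) + δ * ∫ w, cloudMaxw h p v w * g w := by
  have hterm := fun i => integrable_cloudKde_term (p := p) (v := v) hh i hg hle
  have hKw : ∀ w, cloudKde h p v w * g w = ∑ i, p i * gauss h (v i) w * g w := fun w => by
    simp only [cloudKde, Finset.sum_mul]
  have hK : Integrable (fun w => cloudKde h p v w * g w) := by
    simp_rw [hKw]
    exact integrable_finsetSum Finset.univ fun i _ => hterm i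
  have hM := integrable_cloudMaxw_mul (p := p) (v := v) hp hh hg hle
  have hsplit : ∀ w, cloudLaw h δ p v w * g w = (1 - δ) * (cloudKde h p v w * g w) + δ * (cloudMaxw h p v w * g w) :=
    fun w => by unfold cloudLaw; ring
  have hKsum : ∫ w, cloudKde h p v w * g w = ∑ i, p i * ∫ w, gauss h (v i) w * g w := by
    simp_rw [hKw]
    rw [integral_finsetSum _ fun i _ => hterm i]
    refine Finset.sum_congr rfl fun i _ => ?_
    simp_rw [mul_assoc]
    exact integral_const_mul _ _
  simp_rw [hsplit]
  rw [integral_add (hK.const_mul _) (hM.const_mul _), integral_const_mul, integral_const_mul, hKsum]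

/-- **Unit mass**: `∫ f̂ = 1` for a probability cloud. -/
theorem integral_cloudLaw (hp : ∀ i, 0 ≤ p i) (hp1 : ∑ i, p i = 1) (hh : 0 < h) (δ : ℝ) :
    ∫ w, cloudLaw h δ p v w = 1 := by
  have hterm : ∀ i, Integrable (fun w => p i * gauss h (v i) w) := fun i =>
    (integrable_localMaxwellian (pow_pos hh 2) (v i)).const_mul (p i)
  have hK : Integrable (cloudKde h p v) := by
    show Integrable (fun w => ∑ i, p i * gauss h (v i) w)
    exact integrable_finsetSum _ fun i _ => hterm i
  have hM : Integrable (cloudMaxw h p v) := integrable_localMaxwellian (cloudTemp_add_sq_pos hp v hh) _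
  have hKi : ∫ w, cloudKde h p v w = 1 := by
    show ∫ w, ∑ i, p i * gauss h (v i) w = 1
    rw [integral_finsetSum _ fun i _ => hterm i]
    have h1 : ∀ i, ∫ w, p i * gauss h (v i) w = p i := fun i => by
      rw [integral_const_mul]
      exact (congrArg (p i * ·) (integral_localMaxwellian_one (pow_pos hh 2) (v i))).trans (mul_one _)
    simp only [h1, hp1]
  have hMi : ∫ w, cloudMaxw h p v w = 1 := integral_localMaxwellian_one (cloudTemp_add_sq_pos hp v hh) _
  unfold cloudLaw
  rw [integral_add (hK.const_mul _) (hM.const_mul _), integral_const_mul, integral_const_mul, hKi, hMi]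
  ring

/-- The regularised law is integrable. -/
theorem integrable_cloudLaw (hp : ∀ i, 0 ≤ p i) (hp1 : ∑ i, p i = 1) (hh : 0 < h) (δ : ℝ) :
    Integrable (cloudLaw h δ p v) := by
  by_contra hni
  have := integral_cloudLaw (v := v) hp hp1 hh δ
  rw [integral_undef hni] at this
  exact zero_ne_one this

/-- **EXACT IDENTITY, stress channel**: `∫ f̂ p₂ = (1 − δ) Σ_i p_i p₂(v_i)` (tests centred at the cloud mean). -/
theorem integral_cloudLaw_mul_p2Poly (hp : ∀ i, 0 ≤ p i) (hh : 0 < h) (δ : ℝ) (v : Fin n → V3) (j k : Fin 3) :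
    ∫ w, cloudLaw h δ p v w * p2Poly (cloudMean p v) j k w = (1 - δ) * cloudP2 p v j k := by
  rw [integral_cloudLaw_mul hp hh (continuous_p2Poly _ j k) (abs_p2Poly_le _ j k)]
  unfold cloudMaxw
  rw [integral_localMaxwellian_mul_p2Poly (cloudTemp_add_sq_pos hp v hh)]
  simp only [integral_gauss_mul_p2Poly hh, cloudP2, mul_zero, add_zero]

/-- **EXACT IDENTITY, heat-flux channel**: `∫ f̂ p₃ = (1 − δ) Σ_i p_i p₃(v_i)` for a probability cloud (the
co-moving floor: the per-atom shifts `(5/2) h² (v_i − ū)_a` sum to zero). -/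
theorem integral_cloudLaw_mul_p3Poly (hp : ∀ i, 0 ≤ p i) (hp1 : ∑ i, p i = 1) (hh : 0 < h) (δ : ℝ)
    (v : Fin n → V3) (a : Fin 3) :
    ∫ w, cloudLaw h δ p v w * p3Poly (cloudMean p v) a w = (1 - δ) * cloudP3 p v a := by
  rw [integral_cloudLaw_mul hp hh (continuous_p3Poly _ a) (abs_p3Poly_le _ a)]
  unfold cloudMaxw
  rw [integral_localMaxwellian_mul_p3Poly (cloudTemp_add_sq_pos hp v hh)]
  simp only [integral_gauss_mul_p3Poly hh, cloudP3, mul_add, Finset.sum_add_distrib, mul_zero, add_zero]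
  have h0 : ∑ i, p i * (5 / 2 * h ^ 2 * (v i a - cloudMean p v a)) = 0 := by
    have := sum_mul_sub_cloudMean hp1 v a
    calc ∑ i, p i * (5 / 2 * h ^ 2 * (v i a - cloudMean p v a))
        = 5 / 2 * h ^ 2 * ∑ i, p i * (v i a - cloudMean p v a) := by
          rw [Finset.mul_sum]; exact Finset.sum_congr rfl fun i _ => by ring
      _ = 0 := by rw [this, mul_zero]
  rw [h0, mul_zero, add_zero]

end Integrals

end EEP

/-- Registered anchor of this helper file: the regularised law of a probability cloud has unit mass,
`∫ [(1 − δ) Σ_i p_i G_h(· − v_i) + δ M_{1, θ̄ + h², ū}] = 1` (`EEP.integral_cloudLaw`, definitions unfolded). -/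
theorem bhEEPClosure_cloud_anchor : ∀ (n : ℕ) (p : Fin n → ℝ) (v : Fin n → V3) (h δ : ℝ), (∀ i, 0 ≤ p i) → ∑ i, p i = 1 → 0 < h → ∫ w, ((1 - δ) * (∑ i, p i * gauss h (v i) w) + δ * Literature.Analysis.FluidPDE.localMaxwellian 1 ((∑ i, p i * ‖v i - ∑ l, p l • v l‖ ^ 2) / 3 + h ^ 2) (∑ l, p l • v l) w) = 1 :=
  fun _ _ _ _ δ hp hp1 hh => EEP.integral_cloudLaw hp hp1 hh δ

end

end Summit.AtomisticToContinuum.HydrodynamicLimit.Theorems.BlockHDissipation
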